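import Summits.QuantumFields.YangMills.Theorems.BalabanUVNodesN15TwoSpacingGluingNeumannPartition
import Summits.QuantumFields.YangMills.Theorems.BalabanUVNodesN15TwoSpacingGluingCutRowsMargin
import HarnessLib

/-!
# THE GLUING STEP AT TWO LATTICE SPACINGS, XXX: THE COVER's REMAINDER ROW FOR CUBES OF ANY SIDE `S` AND ANY CUBE OPERATOR — the S-general cover geometry (window, cut, margin) and the
# operator-generic row `[Δ_loc + N′, M_{h_k}]∘N_k ≤ 1_{□_k}(y′)·(θ₁ + θ₂ + θ₃βc_r)·e^{−ρd}` from CUT rows of `N_k` in this lineage's `fgrad`∕`bgrad` language, so that BOTH dag-n15-a's images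
# cube on the doubled torus (`S = qw`, FILE 69) AND their LIFTED cube of fixed side `S = L^s` on the torus of record (PROGRAMME P, `…NeumannCubeLift`) instantiate it (dag-n15-c g12, FILE 72)

Cell `pub-ymgap`, seat `pub-ymgap-dag-n15-c` (R134 (a); HUMAN RULING D-0062), generation 12.  `bears_on: R4∕N15 · K3⁷ SpineGivenEndpointR13SepCoPH (stmt-QuantumFields-20544)`.
Filed `--supports stmt-QuantumFields-20544 --as helper` — COUNT-NEUTRAL.  Theorems only (0 `def`, 0 `sorry`).  Imports BY NAME FILES 67∕68 (through them 43–66); nothing in the tree is modified.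

WHY.  FILE 66 tied the cube side to the period (`S = qw` = half the doubled torus, dag-n15-a's images cube); FILE 69 fed dag-n15-a's `neumannCubeG` rows.  PROGRAMME P (dag-n15-a g20,
`…TorusPeriodisation`, `…NeumannCubeLift`: `liftCubeG` with EXACT `M_h∘Δ_a∘G_□ = M_h` for `supp h ⊂ intBonds M n c S` on a torus `M` with `2S ∣ M_ν`) puts cubes of FIXED side `S = L^s` on the
torus of record `M_ν = 2L^{m_T}` — the non-circular edition of the knit.  The cover there is FILE 66's with `q = L^{m_T}∕w` (period `2qw = M_ν`) but cube side `S ≤ qw`: §1 re-proves FILE 66's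
window ∕ cut ∕ margin lemmas with `S` free (`m₀ + 2w + 1 ≤ S`, resp. `2m₀ + 2w + 1 ≤ S ≤ 2qw`); §2 is FILE 69's row assembly with the cube operator ABSTRACT: its cut rows `M_χN`, `M_χ∇_μN`,
`M_χ∇⁻_μN` (two-sided, `β`, `β₁`), its output-cut convolution row `M_χ∘T₁∘N` for `T₁ := [N′, M_{h_k}]` (dag-n15-a N-IIi shape) and the letter of `N′` are HYPOTHESES; the partition letters, cuts,
far sandwich and assembly are this lineage's (FILES 61∕65∕67∕68).
* §1 ★ `mem_intBonds_of_hcube_ne_zero_side`, ★ `chiCube_coverCorner_eq_one_side`, `blockOf_mem_cubeBlocks_of_hcube_ne_zero_side`, `sum_ind_cubeBlocks_le_side`, `card_filter_cubeBlocks_coord_le`, ★★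
  `sum_ind_cubeBlocks_le_overlap` (TRUE overlap `≤ (S∕w + 1)^{d+1}`, uniform in the volume), ★ `margin_le_tdistT_side`.
* §2 ★★ `hasMaj_commOp_lapOp_comp_cover_of` (local part from cut rows), ★★ `hasMaj_far_cover_side`, ★★★ `hasMaj_commOp_comp_cover_of` (the row).

HONEST FRAMING ∕ LIMITS.  Finite lattice geometry + block-majorant bookkeeping ([B6] (2.36)–(2.37) p.229, (2.92)–(2.93) p.239, (2.133)–(2.135) p.247 = SHAPES ∕ MECHANISM); nothing of
[B5]∕[B6]∕[B9] asserted.  NE2⁺ NOT PRINTED, NOT proved; N15 NOT discharged; counts of record UNMOVED (typed 28∕28 · discharged 5∕27); one finite 𝕋⁴ at fixed ε — NOT infinite volume, NOT OS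
on ℝ⁴, NOT a mass gap, NOT Clay; R4 closes the conditional finite-𝕋⁴ rung `BalabanLadder.UV` only.  Restate-immune (no Theses import).
-/

noncomputable section

namespace Summit.QuantumFields.YangMills.BalabanUVNodes.N15.Gluing

open Real
open Literature.MathematicalPhysics.QuantumFieldTheory.Balaban1983to89
open Literature.MathematicalPhysics.QuantumFieldTheory.Balaban1983to89.B5Prop11Plancherel (Tor fine unitVec)
open Literature.MathematicalPhysics.QuantumFieldTheory.Balaban1983to89.B5Block118 (up upHom_intCast)
open Literature.MathematicalPhysics.QuantumFieldTheory.Balaban1983to89.B11SectG (BlockNorm HasMaj RowSum hasMaj_zero)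
open Literature.MathematicalPhysics.QuantumFieldTheory.Balaban1983to89.B6RandomWalk (Triangle254)
open Literature.MathematicalPhysics.QuantumFieldTheory.Balaban1983to89.B6Prop26Gluing (mulOp mulOp_apply ind ind_nonneg ind_le_one)
open Literature.MathematicalPhysics.QuantumFieldTheory.Balaban1983to89.B4TorusKernel.MultiPeriod (circAbs circAbs_add_mul)
open Literature.MathematicalPhysics.QuantumFieldTheory.Balaban1983to89.B4Sect5Torus (tdist circAbs_le_tdist)
open Literature.MathematicalPhysics.QuantumFieldTheory.Balaban1983to89.B6UnitTorusCarrier (unitTorusGeo triangle254_unitTorusGeo rowSum_unitTorusGeo unitTorusGeo_dist_nonneg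
  unitTorusGeo_dist_symm unitTorusGeo_dist_self)
open Literature.MathematicalPhysics.QuantumFieldTheory.King1986.Torus (blockOf val_blockOf tdistT toSite tdistT_nonneg)
open Summit.QuantumFields.YangMills.BalabanUVNodes.N15.BackgroundLayer (fgrad fgradAdj bgrad)
open Summit.QuantumFields.YangMills.BalabanUVNodes.N15.VectorPiece (bshiftEquiv bshiftEquiv_apply bshiftEquiv_symm_apply)
open Summit.QuantumFields.YangMills.BalabanUVNodes.N15.TwoGrid (cubeBlocks mem_cubeBlocks chiCube intBonds mem_intBonds exists_val_sub_eq)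

variable {d : ℕ}

/-! ## §1 The cover's window, cut and margin for cubes of any side `S` -/

section Side

variable {M : Fin (d + 1) → ℕ} [∀ μ, NeZero (M μ)] {n w q m₀ S : ℕ} [NeZero n]

/-- ★ **`supp h_k ⊂` THE INTERIOR BONDS OF THE SIDE-`S` CUBE AT `c(k)`** (`m₀ + 2w + 1 ≤ S`): dag-n15-a's locality hypothesis `hh` for `neumannCubeG` (N-IIIa) AND for `liftCubeG` (P-IIa
`mulOp_comp_deltaOp_comp_liftCubeG`). [cite: Balaban1984PropagatorsII, (2.37)–(2.38) p.229] -/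
theorem mem_intBonds_of_hcube_ne_zero_side (hM : ∀ ν, M ν = 2 * q * w) (hw : 0 < w) (hfit : m₀ + 2 * w + 1 ≤ S) (hS : S ≤ 2 * q * w) {k : Fin (d + 1) → ZMod (2 * q)}
    {b : Tor (fine n M) × Fin (d + 1)} (hb : hcube (2 * q) (coverXi M n w) k b ≠ 0) : b ∈ intBonds M n (coverCorner M w q m₀ k) S := by
  have hn : 1 ≤ n := Nat.one_le_iff_ne_zero.mpr (NeZero.ne n)
  have hwin := fun ν => val_sub_up_of_hcube_ne_zero (m₀ := m₀) hM hw (by omega) hb ν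
  have hup : n * (m₀ + 2 * w) + n ≤ S * n := by nlinarith
  rw [mem_intBonds]
  refine ⟨fun ν => ?_, ?_⟩
  · have := (hwin ν).2
    show ((b.1 - up n M (coverCorner M w q m₀ k)) ν).val < S * n
    omega
  · have := (hwin b.2).2
    show ((b.1 - up n M (coverCorner M w q m₀ k)) b.2).val ≠ S * n - 1
    omega

/-- ★ **THE SIDE-`S` CUT IS `1` ONE STEP AROUND THE SUPPORT** (FILE 65's `hχ` for `χ = chiCube (c k) S`, `m₀ + 2w + 1 ≤ S ≤ 2qw`). [cite: Balaban1984PropagatorsII, (2.37) p.229 (shape)] -/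
theorem chiCube_coverCorner_eq_one_side (hM : ∀ ν, M ν = 2 * q * w) (hw : 0 < w) (hfit : m₀ + 2 * w + 1 ≤ S) (hS : S ≤ 2 * q * w) (μ : Fin (d + 1)) (k : Fin (d + 1) → ZMod (2 * q))
    (x : Tor (fine n M) × Fin (d + 1))
    (hx : ∃ x₀ : Tor (fine n M) × Fin (d + 1), (x₀ = x ∨ x₀ = bshiftEquiv M n μ x ∨ x₀ = (bshiftEquiv M n μ).symm x) ∧
      ∀ ν, |cenRep (2 * q) (coverXi M n w ν x₀ - ((k ν).val : ℝ))| < 1) :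
    chiCube M n (coverCorner M w q m₀ k) S x = 1 := by
  have hn : 1 ≤ n := Nat.one_le_iff_ne_zero.mpr (NeZero.ne n)
  obtain ⟨x₀, hx₀, hc⟩ := hx
  have hwin := fun ν => val_sub_up_of_abs_cenRep_lt_one (m₀ := m₀) hM hw (by omega) (hc ν)
  have hmem : blockOf n M x.1 ∈ cubeBlocks M (coverCorner M w q m₀ k) S := by
    rw [blockOf_mem_cubeBlocks_iff]
    intro ν
    have hN : fine n M ν = n * (2 * q * w) := by show n * M ν = _; rw [hM ν]
    have h2 : ((x₀.1 - up n M (coverCorner M w q m₀ k)) ν).val + 2 ≤ fine n M ν := by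
      have := (hwin ν).2
      calc ((x₀.1 - up n M (coverCorner M w q m₀ k)) ν).val + 2 ≤ n * (2 * q * w) := by nlinarith
        _ = fine n M ν := hN.symm
    have hstep := val_sub_up_le_of_step μ hx₀ ν (by have := (hwin ν).1; omega) h2
    have := (hwin ν).2
    have hup : n * (m₀ + 2 * w) + n ≤ S * n := by nlinarith
    omega
  unfold chiCube
  rw [if_pos hmem]

/-- the block of a point of `supp h_k` is a block of the side-`S` cube. [folklore] -/
theorem blockOf_mem_cubeBlocks_of_hcube_ne_zero_side (hM : ∀ ν, M ν = 2 * q * w) (hw : 0 < w) (hfit : m₀ + 2 * w + 1 ≤ S) (hS : S ≤ 2 * q * w) {k : Fin (d + 1) → ZMod (2 * q)}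
    {b : Tor (fine n M) × Fin (d + 1)} (hb : hcube (2 * q) (coverXi M n w) k b ≠ 0) : blockOf n M b.1 ∈ cubeBlocks M (coverCorner M w q m₀ k) S := by
  have h := chiCube_coverCorner_eq_one_side (m₀ := m₀) hM hw hfit hS 0 k b ⟨b, Or.inl rfl, abs_cenRep_lt_one_of_hcube_ne_zero (2 * q) (coverXi M n w) hb⟩
  unfold chiCube at h
  by_contra hne
  rw [if_neg hne] at h
  exact zero_ne_one h

/-- bounded overlap for side-`S` cubes (crude: their number). [cite: Balaban1984PropagatorsII, (2.134)–(2.135) p.247 (mechanism)] -/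
theorem sum_ind_cubeBlocks_le_side [NeZero q] (L kk : ℕ) (y : Tor M) :
    ∑ k : Fin (d + 1) → ZMod (2 * q), ind (g := unitTorusGeo L kk M) ((cubeBlocks M (coverCorner M w q m₀ k) S : Finset (Tor M)) : Set (Tor M)) y ≤
      (((2 * q) ^ (d + 1) : ℕ) : ℝ) := by
  calc ∑ k : Fin (d + 1) → ZMod (2 * q), ind (g := unitTorusGeo L kk M) ((cubeBlocks M (coverCorner M w q m₀ k) S : Finset (Tor M)) : Set (Tor M)) y
      ≤ ∑ _k : Fin (d + 1) → ZMod (2 * q), (1 : ℝ) := Finset.sum_le_sum fun k _ => ind_le_one _ _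
    _ = (((2 * q) ^ (d + 1) : ℕ) : ℝ) := by
        rw [Finset.sum_const, Finset.card_univ, nsmul_eq_mul, mul_one, Fintype.card_fun, ZMod.card, Fintype.card_fin]

/-- the cubes of the cover containing a given block, counted coordinatewise: in direction `ν` the admissible `k_ν ∈ ℤ∕2q` inject into `{0, …, S∕w}` by `k_ν ↦ val((y − c(k))_ν)∕w`
(corners `w` apart, window `< S`). [folklore] -/
theorem card_filter_cubeBlocks_coord_le (hM : ∀ ν, M ν = 2 * q * w) (hw : 0 < w) [NeZero q] (y : Tor M) (ν : Fin (d + 1)) :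
    (Finset.univ.filter fun j : ZMod (2 * q) => ((y ν - ((((w : ℤ) * ((j.val : ℤ)) - w - m₀ : ℤ)) : ZMod (M ν))).val < S)).card ≤ S / w + 1 := by
  set A := Finset.univ.filter fun j : ZMod (2 * q) => ((y ν - ((((w : ℤ) * ((j.val : ℤ)) - w - m₀ : ℤ)) : ZMod (M ν))).val < S) with hA
  have hT : M ν = 2 * q * w := hM ν
  let f : ZMod (2 * q) → ℕ := fun j => (y ν - ((((w : ℤ) * ((j.val : ℤ)) - w - m₀ : ℤ)) : ZMod (M ν))).val / w
  -- the injection into `range (S / w + 1)`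
  have hmaps : ∀ j ∈ A, f j ∈ Finset.range (S / w + 1) := by
    intro j hj
    rw [hA, Finset.mem_filter] at hj
    rw [Finset.mem_range]
    exact Nat.lt_succ_of_le (Nat.div_le_div_right hj.2.le)
  have hinj : Set.InjOn f (A : Set (ZMod (2 * q))) := by
    intro j hj j' hj' hjj
    rw [Finset.mem_coe, hA, Finset.mem_filter] at hj hj'
    -- the two relative coordinates differ by `w(j′ − j)` modulo `2qw`
    set v : ℕ := ((y ν - ((((w : ℤ) * ((j.val : ℤ)) - w - m₀ : ℤ)) : ZMod (M ν))).val) with hv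
    set v' : ℕ := ((y ν - ((((w : ℤ) * ((j'.val : ℤ)) - w - m₀ : ℤ)) : ZMod (M ν))).val) with hv'
    have hdiff : ∃ e : ℤ, (v : ℤ) - v' = (w : ℤ) * ((j'.val : ℤ) - j.val) + (M ν : ℤ) * e := by
      obtain ⟨e, he⟩ := exists_val_sub_eq (y ν - ((((w : ℤ) * ((j.val : ℤ)) - w - m₀ : ℤ)) : ZMod (M ν))) (y ν - ((((w : ℤ) * ((j'.val : ℤ)) - w - m₀ : ℤ)) : ZMod (M ν)))
      have hsub : (y ν - ((((w : ℤ) * ((j.val : ℤ)) - w - m₀ : ℤ)) : ZMod (M ν))) - (y ν - ((((w : ℤ) * ((j'.val : ℤ)) - w - m₀ : ℤ)) : ZMod (M ν))) =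
          ((((w : ℤ) * ((j'.val : ℤ) - j.val) : ℤ)) : ZMod (M ν)) := by push_cast; ring
      rw [hsub] at he
      obtain ⟨e', he'⟩ : ∃ e' : ℤ, ((((((w : ℤ) * ((j'.val : ℤ) - j.val) : ℤ)) : ZMod (M ν))).val : ℤ) = (w : ℤ) * ((j'.val : ℤ) - j.val) + (M ν : ℤ) * e' := by
        refine ⟨-(((w : ℤ) * ((j'.val : ℤ) - j.val)) / (M ν : ℤ)), ?_⟩
        rw [ZMod.val_intCast]
        have := Int.emod_add_mul_ediv ((w : ℤ) * ((j'.val : ℤ) - j.val)) (M ν : ℤ)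
        linarith
      refine ⟨e' - e, ?_⟩
      rw [hv, hv']
      linarith
    obtain ⟨e, he⟩ := hdiff
    -- same quotient by `w` and both `< S`: `|v − v′| < w`
    have h1 : v / w = v' / w := hjj
    have hq1 := Nat.div_add_mod v w
    have hq2 := Nat.div_add_mod v' w
    have hm1 := Nat.mod_lt v hw
    have hm2 := Nat.mod_lt v' hw
    rw [h1] at hq1
    have hn1 : v < v' + w := by linarith [Nat.zero_le (v' % w)]
    have hn2 : v' < v + w := by linarith [Nat.zero_le (v % w)]
    have hvv : (v : ℤ) - v' < w ∧ (v' : ℤ) - v < w := by constructor <;> omega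
    -- hence `(j′ − j) + 2q·e = 0`, i.e. `j = j′`
    have hjlt := ZMod.val_lt j
    have hj'lt := ZMod.val_lt j'
    have hw' : (0 : ℤ) < w := by exact_mod_cast hw
    rw [hT] at he
    push_cast at he
    have key : ((j'.val : ℤ) - j.val) + 2 * q * e = 0 := by
      by_contra hne
      have h1 : (1 : ℤ) ≤ |((j'.val : ℤ) - j.val) + 2 * q * e| := Int.one_le_abs hne
      have h2 : |(v : ℤ) - v'| < w := abs_sub_lt_iff.mpr ⟨hvv.1, by linarith [hvv.2]⟩
      have h3 : (v : ℤ) - v' = (w : ℤ) * (((j'.val : ℤ) - j.val) + 2 * q * e) := by rw [he]; ring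
      rw [h3, abs_mul, abs_of_pos hw'] at h2
      nlinarith
    have hval : j.val = j'.val := by
      have hq0 : (0 : ℤ) < 2 * q := by exact_mod_cast Nat.pos_of_ne_zero (NeZero.ne (2 * q))
      have : e = 0 := by
        by_contra hne
        rcases lt_or_gt_of_ne hne with h | h
        · nlinarith
        · nlinarith
      subst this
      omega
    exact ZMod.val_injective _ hval
  calc A.card ≤ (Finset.range (S / w + 1)).card := Finset.card_le_card_of_injOn f hmaps hinj
    _ = S / w + 1 := Finset.card_range _

/-- ★★ **THE TRUE OVERLAP OF THE COVER** (uniform in the volume): every block lies in at most `(S∕w + 1)^{d+1}` of the side-`S` cubes `□_k`. [cite: Balaban1984PropagatorsII, (2.134)–(2.135) p.247 (mechanism: bounded overlap)] -/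
theorem sum_ind_cubeBlocks_le_overlap (hM : ∀ ν, M ν = 2 * q * w) (hw : 0 < w) [NeZero q] (L kk : ℕ) (y : Tor M) :
    ∑ k : Fin (d + 1) → ZMod (2 * q), ind (g := unitTorusGeo L kk M) ((cubeBlocks M (coverCorner M w q m₀ k) S : Finset (Tor M)) : Set (Tor M)) y ≤
      (((S / w + 1) ^ (d + 1) : ℕ) : ℝ) := by
  classical
  -- the indicator factorises over the coordinates
  have hind : ∀ k : Fin (d + 1) → ZMod (2 * q), ind (g := unitTorusGeo L kk M) ((cubeBlocks M (coverCorner M w q m₀ k) S : Finset (Tor M)) : Set (Tor M)) y =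
      ∏ ν, (if ((y ν - ((((w : ℤ) * (((k ν).val : ℤ)) - w - m₀ : ℤ)) : ZMod (M ν))).val < S) then (1 : ℝ) else 0) := by
    intro k
    unfold ind
    rw [Finset.mem_coe, mem_cubeBlocks]
    by_cases h : ∀ ν, (y ν - coverCorner M w q m₀ k ν).val < S
    · rw [if_pos h, Finset.prod_eq_one]
      intro ν _
      rw [if_pos]
      exact h ν
    · rw [if_neg h]
      push Not at h
      obtain ⟨ν, hν⟩ := h
      rw [Finset.prod_eq_zero (Finset.mem_univ ν)]
      rw [if_neg]
      exact not_lt.mpr hν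
  simp_rw [hind]
  have key : ∏ ν : Fin (d + 1), ∑ j : ZMod (2 * q), (if ((y ν - ((((w : ℤ) * ((j.val : ℤ)) - w - m₀ : ℤ)) : ZMod (M ν))).val < S) then (1 : ℝ) else 0) =
      ∑ k : Fin (d + 1) → ZMod (2 * q), ∏ ν, (if ((y ν - ((((w : ℤ) * (((k ν).val : ℤ)) - w - m₀ : ℤ)) : ZMod (M ν))).val < S) then (1 : ℝ) else 0) := by
    rw [Finset.prod_univ_sum (fun _ => Finset.univ) (fun ν (j : ZMod (2 * q)) => if ((y ν - ((((w : ℤ) * ((j.val : ℤ)) - w - m₀ : ℤ)) : ZMod (M ν))).val < S) then (1 : ℝ) else 0),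
      Fintype.piFinset_univ]
  rw [← key]
  have hcoord : ∀ ν, ∑ j : ZMod (2 * q), (if ((y ν - ((((w : ℤ) * ((j.val : ℤ)) - w - m₀ : ℤ)) : ZMod (M ν))).val < S) then (1 : ℝ) else 0) ≤ ((S / w + 1 : ℕ) : ℝ) := by
    intro ν
    rw [Finset.sum_boole]
    exact_mod_cast card_filter_cubeBlocks_coord_le (m₀ := m₀) (S := S) hM hw y ν
  calc ∏ ν, ∑ j : ZMod (2 * q), (if ((y ν - ((((w : ℤ) * ((j.val : ℤ)) - w - m₀ : ℤ)) : ZMod (M ν))).val < S) then (1 : ℝ) else 0)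
      ≤ ∏ _ν : Fin (d + 1), ((S / w + 1 : ℕ) : ℝ) := Finset.prod_le_prod (fun ν _ => Finset.sum_nonneg fun _ _ => by positivity) fun ν _ => hcoord ν
    _ = (((S / w + 1) ^ (d + 1) : ℕ) : ℝ) := by rw [Finset.prod_const, Finset.card_univ, Fintype.card_fin]; push_cast; ring

/-- ★ **THE MARGIN for side-`S` cubes**: a block outside `c + [0, S)^{d+1}` and a block of the window `c + [m₀, m₀ + 2w]^{d+1}` are `≥ m₀ + 1` apart (`2m₀ + 2w + 1 ≤ S ≤ 2qw = M_ν`).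
[cite: Balaban1984PropagatorsII, p.239 («ζ_□ … distance ⅓M to the boundary of □»: shape)] -/
theorem margin_le_tdistT_side (hM : ∀ ν, M ν = 2 * q * w) (hfit : 2 * m₀ + 2 * w + 1 ≤ S) (hS : S ≤ 2 * q * w) {c y y' : Tor M} (hy : y ∉ cubeBlocks M c S)
    (hy' : ∀ ν, m₀ ≤ ((y' - c) ν).val ∧ ((y' - c) ν).val + 1 ≤ m₀ + 2 * w) : (m₀ : ℝ) + 1 ≤ tdistT M y y' := by
  rw [mem_cubeBlocks] at hy
  push Not at hy
  obtain ⟨ν, hν⟩ := hy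
  have hP : ∀ i, 1 ≤ M i := fun i => Nat.one_le_iff_ne_zero.mpr (NeZero.ne (M i))
  have hA := ZMod.val_lt ((y - c) ν)
  obtain ⟨hB1, hB2⟩ := hy' ν
  obtain ⟨k₁, hk₁⟩ := exists_val_sub_eq (y ν) (c ν)
  obtain ⟨k₂, hk₂⟩ := exists_val_sub_eq (y' ν) (c ν)
  rw [show (y ν - c ν) = (y - c) ν from rfl] at hk₁
  rw [show (y' ν - c ν) = (y' - c) ν from rfl] at hk₂
  have hle := circAbs_le_tdist hP (toSite M y) (toSite M y') ν
  have hval : (((toSite M y ν).val : ℤ)) - ((toSite M y' ν).val : ℤ) = (((y - c) ν).val : ℤ) - (((y' - c) ν).val : ℤ) + (M ν : ℤ) * (k₂ - k₁) := by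
    show (((y ν).val : ℤ)) - ((y' ν).val : ℤ) = _
    linarith
  rw [hval, circAbs_add_mul] at hle
  set A : ℤ := (((y - c) ν).val : ℤ) with hAdef
  set B : ℤ := (((y' - c) ν).val : ℤ) with hBdef
  have hMν : (M ν : ℤ) = 2 * q * w := by rw [hM ν]; push_cast; ring
  have hA1 : (S : ℤ) ≤ A := by rw [hAdef]; exact_mod_cast hν
  have hA2 : A < 2 * q * w := by rw [hAdef, ← hMν]; exact_mod_cast hA
  have hB1' : (m₀ : ℤ) ≤ B := by rw [hBdef]; exact_mod_cast hB1
  have hB2' : B + 1 ≤ m₀ + 2 * w := by rw [hBdef]; exact_mod_cast hB2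
  have hfit' : 2 * (m₀ : ℤ) + 2 * w + 1 ≤ S := by exact_mod_cast hfit
  have hS' : (S : ℤ) ≤ 2 * q * w := by exact_mod_cast hS
  have hcirc : (m₀ : ℤ) + 1 ≤ circAbs (M ν) (A - B) := by
    unfold circAbs
    rw [hMν, Int.emod_eq_of_lt (by linarith) (by linarith)]
    exact le_min (by linarith) (by linarith)
  have hcast : ((m₀ : ℝ)) + 1 = (((m₀ : ℤ) + 1 : ℤ) : ℝ) := by push_cast; ring
  rw [hcast]
  exact (Int.cast_le.mpr hcirc).trans hle

end Side

/-! ## §2 The remainder row for ANY cube operator with cut rows -/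

section Rows

variable {M : Fin (d + 1) → ℕ} [∀ μ, NeZero (M μ)] {L kk n w q m₀ S : ℕ} [NeZero n]

/-- ★★ **THE LOCAL PART FROM CUT ROWS OF ANY CUBE OPERATOR**: two-sided cut rows `M_χN ≤ 1_□1_□βe^{−δd}`, `M_χ∇_μN, M_χ∇⁻_μN ≤ 1_□1_□β₁e^{−δd}` (this lineage's `fgrad`∕`bgrad`; χ = the side-`S`
cut at `c(k)`) ⟹ `[Σ_μ∇*_μ∇_μ, M_{h_k}]∘N ≤ 1_□1_□·((d+1)(c₂β + 2c₁β₁))·e^{−δd}`, `c₁ = π∕w`, `c₂ = 32π²∕w²` — FILE 63 `hasMaj_commOp_lapOp_comp_of_cut` with FILE 67's letters and §1's cuts.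
[cite: Balaban1984PropagatorsII, (2.133)–(2.134) p.247 (shapes + mechanism)] -/
theorem hasMaj_commOp_lapOp_comp_cover_of (hM : ∀ ν, M ν = 2 * q * w) (hw : 0 < w) (hfit : m₀ + 2 * w + 1 ≤ S) (hS : S ≤ 2 * q * w) (k : Fin (d + 1) → ZMod (2 * q))
    {N : (Tor (fine n M) × Fin (d + 1) → ℝ) →ₗ[ℝ] (Tor (fine n M) × Fin (d + 1) → ℝ)} {β β₁ δ : ℝ}
    (hGc : HasMaj (BlockNorm.ofBlocks (unitTorusGeo L kk M) (fun b : Tor (fine n M) × Fin (d + 1) => blockOf n M b.1))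
      (BlockNorm.ofBlocks (unitTorusGeo L kk M) (fun b : Tor (fine n M) × Fin (d + 1) => blockOf n M b.1)) (mulOp (chiCube M n (coverCorner M w q m₀ k) S) ∘ₗ N)
      (fun y y' => ind ((cubeBlocks M (coverCorner M w q m₀ k) S : Finset (Tor M)) : Set (Tor M)) y * ind ((cubeBlocks M (coverCorner M w q m₀ k) S : Finset (Tor M)) : Set (Tor M)) y' *
        (β * Real.exp (-(δ * tdistT M y y')))))
    (hDc : ∀ μ, HasMaj (BlockNorm.ofBlocks (unitTorusGeo L kk M) (fun b : Tor (fine n M) × Fin (d + 1) => blockOf n M b.1))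
      (BlockNorm.ofBlocks (unitTorusGeo L kk M) (fun b : Tor (fine n M) × Fin (d + 1) => blockOf n M b.1))
      (mulOp (chiCube M n (coverCorner M w q m₀ k) S) ∘ₗ (fgrad (n : ℝ) (bshiftEquiv M n μ) ∘ₗ N))
      (fun y y' => ind ((cubeBlocks M (coverCorner M w q m₀ k) S : Finset (Tor M)) : Set (Tor M)) y * ind ((cubeBlocks M (coverCorner M w q m₀ k) S : Finset (Tor M)) : Set (Tor M)) y' *
        (β₁ * Real.exp (-(δ * tdistT M y y')))))
    (hDbc : ∀ μ, HasMaj (BlockNorm.ofBlocks (unitTorusGeo L kk M) (fun b : Tor (fine n M) × Fin (d + 1) => blockOf n M b.1))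
      (BlockNorm.ofBlocks (unitTorusGeo L kk M) (fun b : Tor (fine n M) × Fin (d + 1) => blockOf n M b.1))
      (mulOp (chiCube M n (coverCorner M w q m₀ k) S) ∘ₗ (bgrad (n : ℝ) (bshiftEquiv M n μ) ∘ₗ N))
      (fun y y' => ind ((cubeBlocks M (coverCorner M w q m₀ k) S : Finset (Tor M)) : Set (Tor M)) y * ind ((cubeBlocks M (coverCorner M w q m₀ k) S : Finset (Tor M)) : Set (Tor M)) y' *
        (β₁ * Real.exp (-(δ * tdistT M y y'))))) :
    HasMaj (BlockNorm.ofBlocks (unitTorusGeo L kk M) (fun b : Tor (fine n M) × Fin (d + 1) => blockOf n M b.1))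
      (BlockNorm.ofBlocks (unitTorusGeo L kk M) (fun b : Tor (fine n M) × Fin (d + 1) => blockOf n M b.1))
      (commOp (lapOp (n : ℝ) (bshiftEquiv M n) 0) (hcube (2 * q) (coverXi M n w) k) ∘ₗ N)
      (fun y y' => ind ((cubeBlocks M (coverCorner M w q m₀ k) S : Finset (Tor M)) : Set (Tor M)) y * ind ((cubeBlocks M (coverCorner M w q m₀ k) S : Finset (Tor M)) : Set (Tor M)) y' *
        (((d + 1 : ℕ) * (32 * π ^ 2 / (w : ℝ) ^ 2 * β + 2 * (π / w * β₁)) + 0) * Real.exp (-(δ * tdistT M y y')))) := by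
  have hχ := fun μ => chiCube_coverCorner_eq_one_side (M := M) (n := n) (m₀ := m₀) hM hw hfit hS μ k
  have hW : HasMaj (BlockNorm.ofBlocks (unitTorusGeo L kk M) (fun b : Tor (fine n M) × Fin (d + 1) => blockOf n M b.1))
      (BlockNorm.ofBlocks (unitTorusGeo L kk M) (fun b : Tor (fine n M) × Fin (d + 1) => blockOf n M b.1))
      (commOp (0 : (Tor (fine n M) × Fin (d + 1) → ℝ) →ₗ[ℝ] (Tor (fine n M) × Fin (d + 1) → ℝ)) (hcube (2 * q) (coverXi M n w) k) ∘ₗ N)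
      (fun y y' => ind ((cubeBlocks M (coverCorner M w q m₀ k) S : Finset (Tor M)) : Set (Tor M)) y * ind ((cubeBlocks M (coverCorner M w q m₀ k) S : Finset (Tor M)) : Set (Tor M)) y' *
        (0 * Real.exp (-(δ * tdistT M y y')))) := by
    rw [show commOp (0 : (Tor (fine n M) × Fin (d + 1) → ℝ) →ₗ[ℝ] (Tor (fine n M) × Fin (d + 1) → ℝ)) (hcube (2 * q) (coverXi M n w) k) = 0 by
      rw [commOp, LinearMap.zero_comp, LinearMap.comp_zero, sub_zero], LinearMap.zero_comp]
    exact (hasMaj_zero _ _).mono fun y y' => le_of_eq (by ring)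
  have key := hasMaj_commOp_lapOp_comp_of_cut (g := unitTorusGeo L kk M) (fun b : Tor (fine n M) × Fin (d + 1) => blockOf n M b.1) (J := Fin (d + 1))
    (e := bshiftEquiv M n) (n := (n : ℝ)) (by positivity : (0 : ℝ) ≤ π / w) (by positivity : (0 : ℝ) ≤ 32 * π ^ 2 / (w : ℝ) ^ 2)
    (fun μ x => abs_fgrad_coverH_le hM hw k μ x) (fun μ x => abs_bgrad_coverH_le hM hw k μ x) (fun μ x => abs_fgradAdj_fgrad_coverH_le hM hw k μ x)
    (fun μ => fgradAdj_fgrad_hcube_cut (2 * q) (coverXi M n w) (bshiftEquiv M n) μ (n : ℝ) (hχ μ))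
    (fun μ => fgrad_hcube_cut (2 * q) (coverXi M n w) (bshiftEquiv M n) μ (n : ℝ) (hχ μ))
    (fun μ => bgrad_hcube_cut (2 * q) (coverXi M n w) (bshiftEquiv M n) μ (n : ℝ) (hχ μ)) hGc hDc hDbc hW
  refine key.mono fun y y' => le_of_eq ?_
  rw [Fintype.card_fin]

/-- ★ **THE COMMUTATOR LETTER OF THE NONLOCAL PART AGAINST THE COVER's PARTITION**: `N′ ≤ c_Ne^{−δ_N d}` ⟹ `[N′, M_{h_k}] ≤ ((π(d+1)∕w)(eε)⁻¹ + 2π(d+1)∕w)·c_N·e^{−(δ_N−ε)d}` — FILE 56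
`hasMaj_commOp_nonlocal` with FILE 67's Lipschitz modulus and oscillation `π(d+1)∕w`. [cite: Balaban1984PropagatorsI, (1.128) p.38 (|dh| small: mechanism)] -/
theorem hasMaj_commOp_coverH (hM : ∀ ν, M ν = 2 * q * w) (hw : 0 < w) (k : Fin (d + 1) → ZMod (2 * q)) {N' : (Tor (fine n M) × Fin (d + 1) → ℝ) →ₗ[ℝ] (Tor (fine n M) × Fin (d + 1) → ℝ)}
    {cN δN ε : ℝ} (hcN : 0 ≤ cN) (hε : 0 < ε)
    (hN' : HasMaj (BlockNorm.ofBlocks (unitTorusGeo L kk M) (fun b : Tor (fine n M) × Fin (d + 1) => blockOf n M b.1))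
      (BlockNorm.ofBlocks (unitTorusGeo L kk M) (fun b : Tor (fine n M) × Fin (d + 1) => blockOf n M b.1)) N' (fun y y' => cN * Real.exp (-(δN * tdistT M y y')))) :
    HasMaj (BlockNorm.ofBlocks (unitTorusGeo L kk M) (fun b : Tor (fine n M) × Fin (d + 1) => blockOf n M b.1))
      (BlockNorm.ofBlocks (unitTorusGeo L kk M) (fun b : Tor (fine n M) × Fin (d + 1) => blockOf n M b.1)) (commOp N' (hcube (2 * q) (coverXi M n w) k))
      (fun y y' => (π * (d + 1) / w * (Real.exp 1 * ε)⁻¹ + 2 * (π * (d + 1) / w)) * cN * Real.exp (-((δN - ε) * tdistT M y y'))) :=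
  hasMaj_commOp_nonlocal (g := unitTorusGeo L kk M) (fun b : Tor (fine n M) × Fin (d + 1) => blockOf n M b.1) (h := hcube (2 * q) (coverXi M n w) k)
    (hb := coverHb M n w q k) hcN (by positivity : (0 : ℝ) ≤ π * (d + 1) / w) (by positivity : (0 : ℝ) ≤ π * (d + 1) / w) hε
    (unitTorusGeo_dist_nonneg L kk M) (unitTorusGeo_dist_symm L kk M) (fun y y' => abs_coverHb_sub_le hM hw k y y') (fun x => abs_coverH_sub_coverHb_le hM hw k x) hN'

/-- ★★ **THE FAR HALF FOR SIDE-`S` CUBES**: `N′ ≤ c_Ne^{−δ_N d}`, `ρ₁ ≤ δ_N` ⟹ `M_{1−χ_k}∘N′∘M_{h_k} ≤ c_N e^{−(δ_N−ρ₁)(m₀+1)}·e^{−ρ₁d}` (`2m₀ + 2w + 1 ≤ S ≤ 2qw`). [cite: Balaban1984PropagatorsII, (2.93) p.239 (mechanism)] -/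
theorem hasMaj_far_cover_side (hM : ∀ ν, M ν = 2 * q * w) (hw : 0 < w) (hfit : 2 * m₀ + 2 * w + 1 ≤ S) (hS : S ≤ 2 * q * w) (k : Fin (d + 1) → ZMod (2 * q))
    {N' : (Tor (fine n M) × Fin (d + 1) → ℝ) →ₗ[ℝ] (Tor (fine n M) × Fin (d + 1) → ℝ)} {cN δN ρ₁ : ℝ} (hcN : 0 ≤ cN) (hρ₁ : ρ₁ ≤ δN)
    (hN' : HasMaj (BlockNorm.ofBlocks (unitTorusGeo L kk M) (fun b : Tor (fine n M) × Fin (d + 1) => blockOf n M b.1))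
      (BlockNorm.ofBlocks (unitTorusGeo L kk M) (fun b : Tor (fine n M) × Fin (d + 1) => blockOf n M b.1)) N' (fun y y' => cN * Real.exp (-(δN * tdistT M y y')))) :
    HasMaj (BlockNorm.ofBlocks (unitTorusGeo L kk M) (fun b : Tor (fine n M) × Fin (d + 1) => blockOf n M b.1))
      (BlockNorm.ofBlocks (unitTorusGeo L kk M) (fun b : Tor (fine n M) × Fin (d + 1) => blockOf n M b.1))
      (mulOp (1 - chiCube M n (coverCorner M w q m₀ k) S) ∘ₗ N' ∘ₗ mulOp (hcube (2 * q) (coverXi M n w) k))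
      (fun y y' => cN * Real.exp (-((δN - ρ₁) * ((m₀ : ℝ) + 1))) * Real.exp (-(ρ₁ * tdistT M y y'))) := by
  refine hasMaj_far_sandwich (g := unitTorusGeo L kk M) (fun b : Tor (fine n M) × Fin (d + 1) => blockOf n M b.1)
    (A := ((cubeBlocks M (coverCorner M w q m₀ k) S : Finset (Tor M)) : Set (Tor M)))
    (H := {y : Tor M | ∀ ν, m₀ ≤ ((y - coverCorner M w q m₀ k) ν).val ∧ ((y - coverCorner M w q m₀ k) ν).val + 1 ≤ m₀ + 2 * w})
    hcN hρ₁ (fun x => ?_) (fun x hx => ?_) (fun x => abs_coverH_le_one k x) (fun x hx => ?_) (fun y y' hy hy' => ?_) hN'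
  · simp only [Pi.sub_apply, Pi.one_apply]
    unfold chiCube; split_ifs <;> norm_num
  · simp only [Pi.sub_apply, Pi.one_apply]
    unfold chiCube; rw [if_pos (Finset.mem_coe.mp hx), sub_self]
  · by_contra hne
    exact hx fun ν => val_blockOf_sub_of_hcube_ne_zero (m₀ := m₀) hM hw (by omega) hne ν
  · exact margin_le_tdistT_side hM hfit hS (fun h => hy (Finset.mem_coe.mpr h)) hy'

/-- ★★★ **THE REMAINDER ROW OF CUBE `k` FOR ANY CUBE OPERATOR WITH CUT ROWS** (`2m₀ + 2w + 1 ≤ S ≤ 2qw`; all rows at one rate `δ`, output `ρ ≤ δ`, `ρ + σ ≤ δ_N − ε`, `ρ + σ ≤ ρ_far ≤ δ_N`):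
cut rows `β`, `β₁` of `N`, the OUTPUT-CUT convolution row `M_χ∘[N′, M_{h_k}]∘N ≤ 1_□1_□θ₂e^{−δd}` (dag-n15-a N-IIi ∕ P-IIb shape, with `T₁ := [N′, M_{h_k}]` whose letter is ★ `hasMaj_commOp_coverH`) and
`N′ ≤ c_Ne^{−δ_N d}` ⟹ `[Σ∇*∇ + N′, M_{h_k}]∘N ≤ 1_□(y′)·((d+1)(c₂β + 2c₁β₁) + θ₂ + c_Ne^{−(δ_N−ρ_far)(m₀+1)}·β·c_r)·e^{−ρd}` — FILE 68's margin assembly.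
[cite: Balaban1984PropagatorsII, (2.92)–(2.93) p.239, (2.134)–(2.135) p.247 (shapes + mechanism); Balaban1984PropagatorsI, (1.121)–(1.128) pp.37–38] -/
theorem hasMaj_commOp_comp_cover_of (hM : ∀ ν, M ν = 2 * q * w) (hw : 0 < w) (hfit : 2 * m₀ + 2 * w + 1 ≤ S) (hS : S ≤ 2 * q * w) (k : Fin (d + 1) → ZMod (2 * q))
    {N N' : (Tor (fine n M) × Fin (d + 1) → ℝ) →ₗ[ℝ] (Tor (fine n M) × Fin (d + 1) → ℝ)} {β β₁ θ₂ δ ρ σ cr cN δN ρf : ℝ} (hβ : 0 ≤ β) (hβ₁ : 0 ≤ β₁) (hθ₂ : 0 ≤ θ₂) (hcN : 0 ≤ cN)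
    (hρ : 0 ≤ ρ) (hρδ : ρ ≤ δ) (hρf : ρ + σ ≤ ρf) (hρfN : ρf ≤ δN) (hrow : RowSum (unitTorusGeo L kk M) σ cr)
    (hGc : HasMaj (BlockNorm.ofBlocks (unitTorusGeo L kk M) (fun b : Tor (fine n M) × Fin (d + 1) => blockOf n M b.1))
      (BlockNorm.ofBlocks (unitTorusGeo L kk M) (fun b : Tor (fine n M) × Fin (d + 1) => blockOf n M b.1)) (mulOp (chiCube M n (coverCorner M w q m₀ k) S) ∘ₗ N)
      (fun y y' => ind ((cubeBlocks M (coverCorner M w q m₀ k) S : Finset (Tor M)) : Set (Tor M)) y * ind ((cubeBlocks M (coverCorner M w q m₀ k) S : Finset (Tor M)) : Set (Tor M)) y' *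
        (β * Real.exp (-(δ * tdistT M y y')))))
    (hDc : ∀ μ, HasMaj (BlockNorm.ofBlocks (unitTorusGeo L kk M) (fun b : Tor (fine n M) × Fin (d + 1) => blockOf n M b.1))
      (BlockNorm.ofBlocks (unitTorusGeo L kk M) (fun b : Tor (fine n M) × Fin (d + 1) => blockOf n M b.1))
      (mulOp (chiCube M n (coverCorner M w q m₀ k) S) ∘ₗ (fgrad (n : ℝ) (bshiftEquiv M n μ) ∘ₗ N))
      (fun y y' => ind ((cubeBlocks M (coverCorner M w q m₀ k) S : Finset (Tor M)) : Set (Tor M)) y * ind ((cubeBlocks M (coverCorner M w q m₀ k) S : Finset (Tor M)) : Set (Tor M)) y' *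
        (β₁ * Real.exp (-(δ * tdistT M y y')))))
    (hDbc : ∀ μ, HasMaj (BlockNorm.ofBlocks (unitTorusGeo L kk M) (fun b : Tor (fine n M) × Fin (d + 1) => blockOf n M b.1))
      (BlockNorm.ofBlocks (unitTorusGeo L kk M) (fun b : Tor (fine n M) × Fin (d + 1) => blockOf n M b.1))
      (mulOp (chiCube M n (coverCorner M w q m₀ k) S) ∘ₗ (bgrad (n : ℝ) (bshiftEquiv M n μ) ∘ₗ N))
      (fun y y' => ind ((cubeBlocks M (coverCorner M w q m₀ k) S : Finset (Tor M)) : Set (Tor M)) y * ind ((cubeBlocks M (coverCorner M w q m₀ k) S : Finset (Tor M)) : Set (Tor M)) y' *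
        (β₁ * Real.exp (-(δ * tdistT M y y')))))
    (hC : HasMaj (BlockNorm.ofBlocks (unitTorusGeo L kk M) (fun b : Tor (fine n M) × Fin (d + 1) => blockOf n M b.1))
      (BlockNorm.ofBlocks (unitTorusGeo L kk M) (fun b : Tor (fine n M) × Fin (d + 1) => blockOf n M b.1))
      (mulOp (chiCube M n (coverCorner M w q m₀ k) S) ∘ₗ (commOp N' (hcube (2 * q) (coverXi M n w) k) ∘ₗ N))
      (fun y y' => ind ((cubeBlocks M (coverCorner M w q m₀ k) S : Finset (Tor M)) : Set (Tor M)) y * ind ((cubeBlocks M (coverCorner M w q m₀ k) S : Finset (Tor M)) : Set (Tor M)) y' *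
        (θ₂ * Real.exp (-(δ * tdistT M y y')))))
    (hN' : HasMaj (BlockNorm.ofBlocks (unitTorusGeo L kk M) (fun b : Tor (fine n M) × Fin (d + 1) => blockOf n M b.1))
      (BlockNorm.ofBlocks (unitTorusGeo L kk M) (fun b : Tor (fine n M) × Fin (d + 1) => blockOf n M b.1)) N' (fun y y' => cN * Real.exp (-(δN * tdistT M y y')))) :
    HasMaj (BlockNorm.ofBlocks (unitTorusGeo L kk M) (fun b : Tor (fine n M) × Fin (d + 1) => blockOf n M b.1))
      (BlockNorm.ofBlocks (unitTorusGeo L kk M) (fun b : Tor (fine n M) × Fin (d + 1) => blockOf n M b.1))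
      (commOp (lapOp (n : ℝ) (bshiftEquiv M n) 0 + N') (hcube (2 * q) (coverXi M n w) k) ∘ₗ N)
      (fun y y' => ind ((cubeBlocks M (coverCorner M w q m₀ k) S : Finset (Tor M)) : Set (Tor M)) y' *
        ((((d + 1 : ℕ) * (32 * π ^ 2 / (w : ℝ) ^ 2 * β + 2 * (π / w * β₁)) + 0) + θ₂ + cN * Real.exp (-((δN - ρf) * ((m₀ : ℝ) + 1))) * β * cr) *
          Real.exp (-(ρ * tdistT M y y')))) := by
  have hfit1 : m₀ + 2 * w + 1 ≤ S := by omega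
  have hKloc := hasMaj_commOp_lapOp_comp_cover_of (L := L) (kk := kk) hM hw hfit1 hS k hGc hDc hDbc
  have hFar := hasMaj_far_cover_side (L := L) (kk := kk) (n := n) hM hw hfit hS k hcN hρfN hN'
  have hcut := hcube_cut (2 * q) (coverXi M n w) (bshiftEquiv M n) 0 (chiCube_coverCorner_eq_one_side (M := M) (n := n) (m₀ := m₀) hM hw hfit1 hS 0 k)
  exact hasMaj_commOp_comp_of_add_cut_margin (g := unitTorusGeo L kk M) (fun b : Tor (fine n M) × Fin (d + 1) => blockOf n M b.1) (triangle254_unitTorusGeo L kk M)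
    (unitTorusGeo_dist_nonneg L kk M) hrow (by positivity) hθ₂ (by positivity) hβ hρ hρδ hρf hcut hKloc hC hFar hGc

end Rows

end Summit.QuantumFields.YangMills.BalabanUVNodes.N15.Gluing

end
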